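import Literature.Barriers.AtomisticToContinuum.AnticontinuumLocalizationGeometry
import Mathlib.LinearAlgebra.Dimension.Constructions
import Mathlib.LinearAlgebra.FiniteDimensional.Basic
import HarnessLib

/-!
# De Roeck–Huveneers 2015, §4.2–4.3: the resonant blocks `B_δ(Q)` and Lemmas 2, 3

`Literature/Barriers/AtomisticToContinuum/` — continuation of `AnticontinuumLocalizationGeometry.lean`.
For a finite linearly independent set `Q` of `r`-bounded modes (`p = |Q|`), the quantities entering
the definition of `B_δ(k_1,…,k_p)` (§4.2) of W. De Roeck, F. Huveneers, CPAM 68 (2015), arXiv:1305.5127: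
`dQ Q ω = ‖P_Q ω‖ = |ω - P(ω, ∩_{k∈Q} π(k))|₂` and, for every linearly independent sub-family
`Q' ⊆ K_r ∩ span Q` (`subFamilies`), `eQ Q Q' ω = ‖P_Q ω - P_{Q'} ω‖`; the (open) ENLARGED block
`InEnlarged` (`dQ < (L^p + 1)δ`, `eQ < (L^p - L^{p'} + 1)δ`) and the CORE conditions
(`dQ ≤ L^pδ`, `eQ ≤ (L^p - L^{p'})δ`: the printed `B_δ(Q)`). PROVED:

* **Lemma 2** (`lemma2_main`, `lemma2_sub`, `eQ_translate_of_mem`): for `k ∈ K_r ∩ span Q`, `ω` in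
  the enlarged block and `|k·ω| ≤ Kδ`, every translate `ω + v` (`v ∈ ℝk`, `‖v‖ ≤ δ`) satisfies the
  CORE main condition and the CORE condition of each sub-family with `k ∉ span Q'`, while the
  quantities of the sub-families with `k ∈ span Q'` do not move — for `L ≥ lemmaL C K`;
* **Lemma 3** (`lemma3`): for a bounded `k ∉ span Q`, `ω` in the enlarged block of `Q` and `|k·ω| ≤ Kδ`,
  `ω` satisfies the CORE conditions of `Q ∪ {k}` — for `L ≥ lemmaL C K`.
-/

noncomputable section

open Function Set Finset Filter Metric WithLp Module
open scoped BigOperators Topology InnerProductSpace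

namespace Literature.Barriers.AtomisticToContinuum.HeatConduction.RotorChain

open Literature.MathematicalPhysics.KineticTheory.HeatConduction

variable {m : ℕ}

/-! ### Bounded modes, linear independence, sub-families -/

/-- The `r`-bounded nonzero modes of the window (a superset of `K_r`), a finite set.
[cite: DeRoeckHuveneers2015, §4.1 (`K_r`)] -/
def BModes (m r : ℕ) : Finset (Fin m → ℤ) :=
  ((Set.Finite.pi fun _ : Fin m => Set.finite_Icc (-(r : ℤ)) r).subset
    (fun k (hk : k ≠ 0 ∧ ∀ y, |k y| ≤ (r : ℤ)) => Set.mem_univ_pi.2 fun y => Set.mem_Icc.2 (abs_le.1 (hk.2 y)))).toFinset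

/-- Membership in `BModes`. [folklore] -/
theorem mem_BModes {m r : ℕ} {k : Fin m → ℤ} : k ∈ BModes m r ↔ k ≠ 0 ∧ ∀ y, |k y| ≤ (r : ℤ) := by
  rw [BModes, Set.Finite.mem_toFinset]; rfl

/-- Members of `K_r` are bounded modes. [folklore] -/
theorem mem_BModes_of_isKMode {r : ℕ} {k : Fin m → ℤ} (hk : IsKMode r k) : k ∈ BModes m r := mem_BModes.2 ⟨hk.1, hk.2.1⟩

/-- Linear independence of a finite set of modes (as real vectors). [cite: DeRoeckHuveneers2015, §4.1] -/
def IsLI (Q : Finset (Fin m → ℤ)) : Prop := LinearIndepOn ℝ (kvec (m := m)) (Q : Set (Fin m → ℤ))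

/-- `dim span Q = |Q|` for linearly independent `Q`. [folklore] -/
theorem finrank_modeSpan {Q : Finset (Fin m → ℤ)} (hQ : IsLI Q) : finrank ℝ (modeSpan Q) = Q.card := by
  have h := finrank_span_eq_card hQ
  have e : Set.range (fun k : (Q : Set (Fin m → ℤ)) => kvec (k : Fin m → ℤ)) = kvec '' (Q : Set (Fin m → ℤ)) := by
    ext v; simp
  rw [e] at h
  rw [modeSpan, h]
  simp

/-- A sub-family inside `span Q` has at most `|Q|` members. [folklore] -/
theorem card_le_of_isLI_of_le {Q Q' : Finset (Fin m → ℤ)} (hQ : IsLI Q) (hQ' : IsLI Q') (hle : modeSpan Q' ≤ modeSpan Q) :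
    Q'.card ≤ Q.card := by
  rw [← finrank_modeSpan hQ, ← finrank_modeSpan hQ']
  exact Submodule.finrank_mono hle

/-- A full-size sub-family inside `span Q` spans it. [folklore] -/
theorem modeSpan_eq_of_card_eq {Q Q' : Finset (Fin m → ℤ)} (hQ : IsLI Q) (hQ' : IsLI Q') (hle : modeSpan Q' ≤ modeSpan Q)
    (hcard : Q'.card = Q.card) : modeSpan Q' = modeSpan Q :=
  Submodule.eq_of_le_of_finrank_eq hle (by rw [finrank_modeSpan hQ, finrank_modeSpan hQ', hcard])

/-- Singletons of nonzero modes are linearly independent. [folklore] -/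
theorem isLI_singleton {k : Fin m → ℤ} (hk : k ≠ 0) : IsLI ({k} : Finset (Fin m → ℤ)) := by
  unfold IsLI; rw [Finset.coe_singleton]; exact LinearIndepOn.singleton (kvec_ne_zero hk)

/-- Inserting a mode outside the span keeps linear independence. [folklore] -/
theorem IsLI.insert {Q : Finset (Fin m → ℤ)} (hQ : IsLI Q) {k : Fin m → ℤ} (hk : kvec k ∉ modeSpan Q) : IsLI (insert k Q) := by
  have hkQ : k ∉ (Q : Set (Fin m → ℤ)) := fun h => hk (kvec_mem_modeSpan h)
  unfold IsLI; rw [Finset.coe_insert]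
  exact (linearIndepOn_insert hkQ).2 ⟨hQ, hk⟩

/-- The span of a singleton. [folklore] -/
theorem modeSpan_singleton (k : Fin m → ℤ) : modeSpan ({k} : Finset (Fin m → ℤ)) = ℝ ∙ kvec k := by
  rw [modeSpan, Finset.coe_singleton, Set.image_singleton]

open scoped Classical in
/-- **The sub-families of `Q`**: nonempty linearly independent sets of bounded modes inside `span Q`
("for every linearly independent `k'_1, …, k'_{p'} ∈ K_r ∩ span{k_1, …, k_p}`"). [cite: DeRoeckHuveneers2015, §4.2 (definition of `B_δ(k_1,…,k_p)`)] -/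
def subFamilies (r : ℕ) (Q : Finset (Fin m → ℤ)) : Finset (Finset (Fin m → ℤ)) :=
  (BModes m r).powerset.filter fun Q' => Q'.Nonempty ∧ IsLI Q' ∧ modeSpan Q' ≤ modeSpan Q

variable {r : ℕ}

/-- Membership in `subFamilies`. [folklore] -/
theorem mem_subFamilies {Q Q' : Finset (Fin m → ℤ)} :
    Q' ∈ subFamilies r Q ↔ Q' ⊆ BModes m r ∧ Q'.Nonempty ∧ IsLI Q' ∧ modeSpan Q' ≤ modeSpan Q := by
  classical
  simp [subFamilies]

/-- `{k}` is a sub-family of any `Q` with `k ∈ K_r ∩ span Q`. [folklore] -/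
theorem singleton_mem_subFamilies {Q : Finset (Fin m → ℤ)} {k : Fin m → ℤ} (hk : k ∈ BModes m r) (hkV : kvec k ∈ modeSpan Q) :
    ({k} : Finset (Fin m → ℤ)) ∈ subFamilies r Q := by
  refine mem_subFamilies.2 ⟨Finset.singleton_subset_iff.2 hk, Finset.singleton_nonempty k, isLI_singleton (mem_BModes.1 hk).1, ?_⟩
  rw [modeSpan_singleton]; exact (Submodule.span_singleton_le_iff_mem _ _).2 hkV

/-- Inserting `k ∈ K_r ∩ span Q`, `k ∉ span Q'`, into a sub-family gives a sub-family. [folklore] -/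
theorem insert_mem_subFamilies {Q Q' : Finset (Fin m → ℤ)} (hQ' : Q' ∈ subFamilies r Q) {k : Fin m → ℤ} (hk : k ∈ BModes m r)
    (hkV : kvec k ∈ modeSpan Q) (hkQ' : kvec k ∉ modeSpan Q') : insert k Q' ∈ subFamilies r Q := by
  obtain ⟨hsub, -, hli, hle⟩ := mem_subFamilies.1 hQ'
  refine mem_subFamilies.2 ⟨Finset.insert_subset hk hsub, Finset.insert_nonempty k Q', hli.insert hkQ', ?_⟩
  rw [modeSpan_insert]; exact sup_le hle ((Submodule.span_singleton_le_iff_mem _ _).2 hkV)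

/-- Sub-families of a sub-family's span are sub-families. [folklore] -/
theorem subFamilies_of_le {Q Q'' : Finset (Fin m → ℤ)} (hle : modeSpan Q'' ≤ modeSpan Q) {Q' : Finset (Fin m → ℤ)}
    (hQ' : Q' ∈ subFamilies r Q'') : Q' ∈ subFamilies r Q := by
  obtain ⟨h1, h2, h3, h4⟩ := mem_subFamilies.1 hQ'
  exact mem_subFamilies.2 ⟨h1, h2, h3, h4.trans hle⟩

/-! ### The resonance quantities -/

/-- `d_Q(ω) = ‖P_Q ω‖ = |ω - P(ω, ∩_{k∈Q} π(k))|₂`. [cite: DeRoeckHuveneers2015, §4.2 (first condition in the definition of `B_δ(k_1,…,k_p)`)] -/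
def dQ (Q : Finset (Fin m → ℤ)) (ω : Euc m) : ℝ := ‖proj Q ω‖

/-- `e_{Q,Q'}(ω) = ‖P_Q ω - P_{Q'} ω‖ = |P(ω, ∩π') - P(ω, ∩π)|₂`. [cite: DeRoeckHuveneers2015, §4.2 (second condition in the definition of `B_δ(k_1,…,k_p)`)] -/
def eQ (Q Q' : Finset (Fin m → ℤ)) (ω : Euc m) : ℝ := ‖proj Q ω - proj Q' ω‖

/-- `0 ≤ d_Q`. [folklore] -/
theorem dQ_nonneg (Q : Finset (Fin m → ℤ)) (ω : Euc m) : 0 ≤ dQ Q ω := norm_nonneg _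

/-- `0 ≤ e_{Q,Q'}`. [folklore] -/
theorem eQ_nonneg (Q Q' : Finset (Fin m → ℤ)) (ω : Euc m) : 0 ≤ eQ Q Q' ω := norm_nonneg _

/-- Nested projections for nested spans. [folklore] -/
theorem proj_proj_of_le {Q Q' : Finset (Fin m → ℤ)} (h : modeSpan Q' ≤ modeSpan Q) (ω : Euc m) : proj Q' (proj Q ω) = proj Q' ω := by
  have := Submodule.starProjection_comp_starProjection_of_le h
  exact congrArg (fun f : Euc m →L[ℝ] Euc m => f ω) this

/-- **Pythagoras**: `d_Q² = d_{Q'}² + e_{Q,Q'}²` for `span Q' ≤ span Q`. [cite: DeRoeckHuveneers2015, §4.3 proof of Lemma 2 ("the decompositions `|ω'|₂² = |ω' - P(ω', ∩π')|₂² + |P(ω', ∩π')|₂²`")] -/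
theorem dQ_sq_eq {Q Q' : Finset (Fin m → ℤ)} (h : modeSpan Q' ≤ modeSpan Q) (ω : Euc m) :
    dQ Q ω ^ 2 = dQ Q' ω ^ 2 + eQ Q Q' ω ^ 2 := by
  have hp := (modeSpan Q').norm_sq_eq_add_norm_sq_starProjection (proj Q ω)
  have e1 : (modeSpan Q').starProjection (proj Q ω) = proj Q' ω := proj_proj_of_le h ω
  have e2 : (modeSpan Q')ᗮ.starProjection (proj Q ω) = proj Q ω - proj Q' ω := by
    have := (modeSpan Q').starProjection_add_starProjection_orthogonal (proj Q ω)
    rw [e1] at this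
    exact eq_sub_of_add_eq' this
  rw [e1, e2] at hp
  exact hp

/-- `e_{Q,Q'} ≤ d_Q`. [folklore] -/
theorem eQ_le_dQ {Q Q' : Finset (Fin m → ℤ)} (h : modeSpan Q' ≤ modeSpan Q) (ω : Euc m) : eQ Q Q' ω ≤ dQ Q ω := by
  have := dQ_sq_eq h ω
  nlinarith [dQ_nonneg Q ω, dQ_nonneg Q' ω, eQ_nonneg Q Q' ω]

/-- `e_{Q,Q'} = 0` when the spans agree. [folklore] -/
theorem eQ_eq_zero_of_eq {Q Q' : Finset (Fin m → ℤ)} (h : modeSpan Q' = modeSpan Q) (ω : Euc m) : eQ Q Q' ω = 0 := by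
  unfold eQ proj
  rw [starProjection_congr h, sub_self, norm_zero]

/-- **Translations inside `span Q`**: `P_Q(ω + v) = P_Q ω + v` for `v ∈ span Q`. [cite: DeRoeckHuveneers2015, §4.3 proof of Lemma 2] -/
theorem proj_add_of_mem {Q : Finset (Fin m → ℤ)} {v : Euc m} (hv : v ∈ modeSpan Q) (ω : Euc m) : proj Q (ω + v) = proj Q ω + v := by
  rw [map_add]; congr 1; exact (Submodule.starProjection_eq_self_iff).2 hv

/-- Sub-family quantities do not move along `v ∈ span Q'`. [cite: DeRoeckHuveneers2015, §4.3 proof of Lemma 2 ("if `k ∈ span{k'_1, …, k'_{p'}}`, then [the second condition] is actually satisfied for all `t ∈ ℝ`")] -/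
theorem eQ_translate_of_mem {Q Q' : Finset (Fin m → ℤ)} (h : modeSpan Q' ≤ modeSpan Q) {v : Euc m} (hv : v ∈ modeSpan Q') (ω : Euc m) :
    eQ Q Q' (ω + v) = eQ Q Q' ω := by
  unfold eQ
  rw [proj_add_of_mem (h hv), proj_add_of_mem hv]
  congr 1; abel

/-- Sub-family quantities move by at most `‖v‖` along `v ∈ span Q`. [cite: DeRoeckHuveneers2015, §4.3 proof of Lemma 2 ("Since `|k|₂ ≤ r²`, this will imply [the second condition]")] -/
theorem eQ_translate_le {Q Q' : Finset (Fin m → ℤ)} {v : Euc m} (hv : v ∈ modeSpan Q) (ω : Euc m) :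
    eQ Q Q' (ω + v) ≤ eQ Q Q' ω + ‖v‖ := by
  unfold eQ
  rw [proj_add_of_mem hv, map_add]
  calc ‖proj Q ω + v - (proj Q' ω + proj Q' v)‖ = ‖(proj Q ω - proj Q' ω) + (v - proj Q' v)‖ := by congr 1; abel
    _ ≤ ‖proj Q ω - proj Q' ω‖ + ‖v - proj Q' v‖ := norm_add_le _ _
    _ ≤ ‖proj Q ω - proj Q' ω‖ + ‖v‖ := by
        gcongr
        have h := (modeSpan Q').norm_sq_eq_add_norm_sq_starProjection v
        have e : (modeSpan Q')ᗮ.starProjection v = v - proj Q' v := by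
          have := (modeSpan Q').starProjection_add_starProjection_orthogonal v
          exact eq_sub_of_add_eq' this
        rw [e] at h
        nlinarith [norm_nonneg (v - proj Q' v), norm_nonneg v, norm_nonneg ((modeSpan Q').starProjection v)]

/-- The main quantity along `v ∈ span Q`: `d_Q(ω + v) = ‖P_Q ω + v‖`. [folklore] -/
theorem dQ_translate {Q : Finset (Fin m → ℤ)} {v : Euc m} (hv : v ∈ modeSpan Q) (ω : Euc m) : dQ Q (ω + v) = ‖proj Q ω + v‖ := by
  unfold dQ; rw [proj_add_of_mem hv]

/-- The resonant distance of a singleton: `d_{{k}}(ω) = |⟪k,ω⟫|/‖k‖ ≤ |⟪k,ω⟫|`. [cite: DeRoeckHuveneers2015, §4.3 proof of Prop. 2, first claim ("`|k·ω''|/|k|₂ = |ω'' - P(ω'', π(k))|`")] -/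
theorem dQ_singleton_le {k : Fin m → ℤ} (hk : k ≠ 0) (ω : Euc m) : dQ {k} ω ≤ |⟪kvec k, ω⟫_ℝ| := by
  have hmem : proj {k} ω ∈ ℝ ∙ kvec k := by rw [← modeSpan_singleton]; exact proj_mem {k} ω
  obtain ⟨c, hc⟩ := Submodule.mem_span_singleton.1 hmem
  have h1 := one_le_norm_kvec hk
  have hinner : ⟪kvec k, ω⟫_ℝ = c * ‖kvec k‖ ^ 2 := by
    rw [inner_kvec_eq_inner_proj (Finset.mem_singleton_self k), ← hc, inner_smul_right, real_inner_self_eq_norm_sq]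
  unfold dQ
  rw [← hc, norm_smul, Real.norm_eq_abs, hinner, abs_mul, abs_of_nonneg (sq_nonneg ‖kvec k‖)]
  nlinarith [abs_nonneg c, norm_nonneg (kvec k), mul_nonneg (abs_nonneg c) (norm_nonneg (kvec k))]

/-! ### The blocks -/

/-- **The enlarged block** (open): `d_Q < (L^p + 1)δ` and `e_{Q,Q'} < (L^p - L^{p'} + 1)δ` for all
sub-families. [cite: DeRoeckHuveneers2015, §4.2 (definition of `B_δ(k_1,…,k_p)`, enlarged by `δ` for the smooth version)] -/
def InEnlarged (r : ℕ) (L δ : ℝ) (Q : Finset (Fin m → ℤ)) (ω : Euc m) : Prop :=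
  dQ Q ω < (L ^ Q.card + 1) * δ ∧ ∀ Q' ∈ subFamilies r Q, eQ Q Q' ω < (L ^ Q.card - L ^ Q'.card + 1) * δ

/-- **The core block `B_δ(Q)`**: `d_Q ≤ L^pδ` and `e_{Q,Q'} ≤ (L^p - L^{p'})δ`. [cite: DeRoeckHuveneers2015, §4.2 (definition of `B_δ(k_1,…,k_p)`)] -/
def InCore (r : ℕ) (L δ : ℝ) (Q : Finset (Fin m → ℤ)) (ω : Euc m) : Prop :=
  dQ Q ω ≤ L ^ Q.card * δ ∧ ∀ Q' ∈ subFamilies r Q, eQ Q Q' ω ≤ (L ^ Q.card - L ^ Q'.card) * δ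

/-- The property of a Lemma-1 constant (with `C ≥ 1`). [cite: DeRoeckHuveneers2015, §4.3 Lemma 1] -/
def IsLemma1Const (m r : ℕ) (C : ℝ) : Prop :=
  1 ≤ C ∧ ∀ (Q : Finset (Fin m → ℤ)) (k : Fin m → ℤ), (∀ k' ∈ Q, ∀ y, |k' y| ≤ (r : ℤ)) → (∀ y, |k y| ≤ (r : ℤ)) →
    kvec k ∉ modeSpan Q → ∀ ω : Euc m, ‖proj (insert k Q) ω‖ ≤ C * (|⟪kvec k, ω⟫_ℝ| + ‖proj Q ω‖)

/-- A Lemma-1 constant exists. [cite: DeRoeckHuveneers2015, §4.3 Lemma 1] -/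
theorem exists_isLemma1Const (m r : ℕ) : ∃ C : ℝ, IsLemma1Const m r C := by
  obtain ⟨C, hC0, hC⟩ := exists_lemma1_const m r
  refine ⟨max C 1, le_max_right _ _, fun Q k hQ hk hkQ ω => (hC Q k hQ hk hkQ ω).trans ?_⟩
  exact mul_le_mul_of_nonneg_right (le_max_left _ _) (by positivity)

/-- The threshold for `L` in Lemmas 2 and 3: `L ≥ 2C²(6 + K²) + C(K + 2) + 4`. [cite: DeRoeckHuveneers2015, §4.3 Lemmas 2 and 3 ("If, given `K < +∞`, `L` is taken large enough")] -/
def lemmaL (C K : ℝ) : ℝ := 2 * C ^ 2 * (6 + K ^ 2) + C * (K + 2) + 4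

/-- `(a + b)² ≤ 2a² + 2b²`. [folklore] -/
theorem sq_add_le_two (a b : ℝ) : (a + b) ^ 2 ≤ 2 * a ^ 2 + 2 * b ^ 2 := by nlinarith [sq_nonneg (a - b)]

/-- The real-variable inequality behind Lemma 2: with `A = L^p ≥ LB`, `B = L^{p'} ≥ 1`, `C' ≥ 1`,
`L ≥ C'(6 + K²)`: `C'K² + (C'-1)(A+1)² + (A - LB + 1)² ≤ C'(A - B - 1)²`. [cite: DeRoeckHuveneers2015, §4.3 end of the proof of Lemma 2 (the inequality in `μ`, `ν`)] -/
theorem lemma2_arith {A B L C' K : ℝ} (hA1 : 1 ≤ A) (hB1 : 1 ≤ B) (hC'1 : 1 ≤ C') (hBL : L * B ≤ A) (hLC : C' * (6 + K ^ 2) ≤ L) :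
    C' * K ^ 2 + (C' - 1) * (A + 1) ^ 2 + (A - L * B + 1) ^ 2 ≤ C' * (A - B - 1) ^ 2 := by
  have hL0 : 0 ≤ L := le_trans (by positivity) hLC
  have hLB0 : 0 ≤ L * B := by positivity
  have h1 : (L * B) * (L * B) ≤ (L * B) * (A + 1) := mul_le_mul_of_nonneg_left (by linarith) hLB0
  have h2 : (A + 1) * (B + 2) ≤ (A + 1) * (3 * B) := mul_le_mul_of_nonneg_left (by linarith) (by linarith)
  have h2' : C' * ((A + 1) * (B + 2)) ≤ C' * ((A + 1) * (3 * B)) := mul_le_mul_of_nonneg_left h2 (by linarith)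
  have hL6 : 0 ≤ L - 6 * C' := by nlinarith [sq_nonneg K]
  have h3 : (L - 6 * C') ≤ (L - 6 * C') * B := le_mul_of_one_le_right hL6 hB1
  have h4 : (L - 6 * C') * B ≤ (L - 6 * C') * B * (A + 1) := le_mul_of_one_le_right (by positivity) (by linarith)
  have h5 : 0 ≤ C' * (B + 2) ^ 2 := by positivity
  have hK : C' * K ^ 2 ≤ L - 6 * C' := by nlinarith
  have e1 : C' * (A - B - 1) ^ 2 - (C' * K ^ 2 + (C' - 1) * (A + 1) ^ 2 + (A - L * B + 1) ^ 2) =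
      2 * ((L * B) * (A + 1)) - (L * B) * (L * B) - 2 * (C' * ((A + 1) * (B + 2))) + C' * (B + 2) ^ 2 - C' * K ^ 2 := by ring
  have e2 : (L * B) * (A + 1) - 2 * (C' * ((A + 1) * (3 * B))) = (L - 6 * C') * B * (A + 1) := by ring
  linarith [e1, e2, h1, h2', h3, h4, h5, hK]

/-! ### Lemma 2 -/

section Lemma2

variable {C K L δ : ℝ} {Q : Finset (Fin m → ℤ)} {k : Fin m → ℤ} {ω v : Euc m}

/-- **Lemma 2, the key slack**: with `k ∈ K_r ∩ span Q`, `k ∉ span Q'` for a sub-family `Q'`,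
`ω` in the enlarged block and `|⟪k,ω⟫| ≤ Kδ`: `e_{Q,Q'}(ω) ≤ (L^p - L^{p'} - 1)δ`.
[cite: DeRoeckHuveneers2015, §4.3 proof of Lemma 2 ("We will show that, because `|k·ω| ≤ Kδ`, then in fact `|P(ω', π(k'_1) ∩ … ∩ π(k'_{p'}))|₂ ≤ (L^p - L^{p'} - r²)δ`")] -/
theorem lemma2_slack (hC : IsLemma1Const m r C) (hK : 0 ≤ K) (hL : lemmaL C K ≤ L) (hδ : 0 < δ)
    (hQli : IsLI Q) (hk : k ∈ BModes m r) (hkV : kvec k ∈ modeSpan Q)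
    (hω : InEnlarged r L δ Q ω) (hres : |⟪kvec k, ω⟫_ℝ| ≤ K * δ)
    {Q' : Finset (Fin m → ℤ)} (hQ' : Q' ∈ subFamilies r Q) (hkQ' : kvec k ∉ modeSpan Q') :
    eQ Q Q' ω ≤ (L ^ Q.card - L ^ Q'.card - 1) * δ := by
  obtain ⟨hQ'sub, hQ'ne, hQ'li, hQ'le⟩ := mem_subFamilies.1 hQ'
  -- the extended sub-family
  have hQ'' : insert k Q' ∈ subFamilies r Q := insert_mem_subFamilies hQ' hk hkV hkQ'
  obtain ⟨-, -, hQ''li, hQ''le⟩ := mem_subFamilies.1 hQ''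
  have hkQ'f : k ∉ Q' := fun h => hkQ' (kvec_mem_modeSpan h)
  have hcard'' : (insert k Q').card = Q'.card + 1 := Finset.card_insert_of_notMem hkQ'f
  have hp'' : Q'.card + 1 ≤ Q.card := by rw [← hcard'']; exact card_le_of_isLI_of_le hQli hQ''li hQ''le
  have hp'1 : 1 ≤ Q'.card := Finset.card_pos.2 hQ'ne
  -- names
  set p : ℕ := Q.card with hp
  set p' : ℕ := Q'.card with hp'
  set A : ℝ := L ^ p with hA
  set B : ℝ := L ^ p' with hB
  set x : ℝ := dQ Q ω with hx
  set e' : ℝ := eQ Q Q' ω with he'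
  set e'' : ℝ := eQ Q (insert k Q') ω with he''
  set y' : ℝ := dQ Q' ω with hy'
  set y'' : ℝ := dQ (insert k Q') ω with hy''
  have hC1 : 1 ≤ C := hC.1
  have hL4 : 4 ≤ L := by
    have : 0 ≤ 2 * C ^ 2 * (6 + K ^ 2) + C * (K + 2) := by positivity
    rw [lemmaL] at hL; linarith
  have hL1 : 1 ≤ L := by linarith
  have hA1 : 1 ≤ A := one_le_pow₀ hL1
  have hB1 : 1 ≤ B := one_le_pow₀ hL1
  have hBL : L * B ≤ A := by
    rw [hA, hB, ← pow_succ']; exact pow_le_pow_right₀ hL1 hp''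
  have hBA : B ≤ A := le_trans (le_mul_of_one_le_left (by linarith) hL1) hBL
  -- Pythagoras twice
  have hpy1 : x ^ 2 = y' ^ 2 + e' ^ 2 := dQ_sq_eq hQ'le ω
  have hpy2 : x ^ 2 = y'' ^ 2 + e'' ^ 2 := dQ_sq_eq hQ''le ω
  -- Lemma 1 for `(Q', k)`
  have hL1b := hC.2 Q' k (fun k' hk' => (mem_BModes.1 (hQ'sub hk')).2) (mem_BModes.1 hk).2 hkQ' ω
  have hy''b : y'' ≤ C * (K * δ + y') := hL1b.trans (mul_le_mul_of_nonneg_left (add_le_add hres le_rfl) (by linarith))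
  -- block conditions
  have hxb : x < (A + 1) * δ := hω.1
  have he''b : e'' < (A - L * B + 1) * δ := by
    have h := hω.2 _ hQ''
    rw [hcard'', pow_succ, mul_comm (L ^ p') L] at h
    exact h
  -- squares
  set C' : ℝ := 2 * C ^ 2 with hC'
  have hC'1 : 1 ≤ C' := by rw [hC']; have := one_le_pow₀ (M₀ := ℝ) hC1 (n := 2); linarith
  have hy''sq : y'' ^ 2 ≤ C' * (K ^ 2 * δ ^ 2 + y' ^ 2) := by
    have h0 : 0 ≤ y'' := dQ_nonneg _ _
    have h1 : 0 ≤ K * δ + y' := by have := dQ_nonneg Q' ω; positivity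
    calc y'' ^ 2 ≤ (C * (K * δ + y')) ^ 2 := pow_le_pow_left₀ h0 hy''b 2
      _ = C ^ 2 * (K * δ + y') ^ 2 := by ring
      _ ≤ C ^ 2 * (2 * (K * δ) ^ 2 + 2 * y' ^ 2) := mul_le_mul_of_nonneg_left (sq_add_le_two _ _) (sq_nonneg C)
      _ = C' * (K ^ 2 * δ ^ 2 + y' ^ 2) := by rw [hC']; ring
  -- the inequality "that cannot be violated": `C' e'² ≤ C' K²δ² + (C'-1) x² + e''²`
  have hpy1' : C' * x ^ 2 = C' * y' ^ 2 + C' * e' ^ 2 := by rw [hpy1]; ring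
  have hkey : C' * e' ^ 2 ≤ C' * (K ^ 2 * δ ^ 2) + (C' - 1) * x ^ 2 + e'' ^ 2 := by linarith [hy''sq, hpy1', hpy2]
  have hx2 : x ^ 2 ≤ ((A + 1) * δ) ^ 2 := pow_le_pow_left₀ (dQ_nonneg _ _) hxb.le 2
  have he''2 : e'' ^ 2 ≤ ((A - L * B + 1) * δ) ^ 2 := pow_le_pow_left₀ (eQ_nonneg _ _ _) he''b.le 2
  -- hence `C' e'² ≤ [C'K² + (C'-1)(A+1)² + (A - LB + 1)²] δ² ≤ C'(A - B - 1)² δ²`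
  have hC'0 : 0 < C' := by linarith
  have htarget : C' * K ^ 2 + (C' - 1) * (A + 1) ^ 2 + (A - L * B + 1) ^ 2 ≤ C' * (A - B - 1) ^ 2 := by
    have hLC : C' * (6 + K ^ 2) ≤ L := by
      have : 0 ≤ C * (K + 2) := by positivity
      rw [lemmaL] at hL; rw [hC']; linarith
    exact lemma2_arith hA1 hB1 hC'1 hBL hLC
  have he'sq : e' ^ 2 ≤ ((A - B - 1) * δ) ^ 2 := by
    have h1 : C' * e' ^ 2 ≤ (C' * K ^ 2 + (C' - 1) * (A + 1) ^ 2 + (A - L * B + 1) ^ 2) * δ ^ 2 := by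
      have h1C : 0 ≤ C' - 1 := by linarith
      calc C' * e' ^ 2 ≤ C' * (K ^ 2 * δ ^ 2) + (C' - 1) * x ^ 2 + e'' ^ 2 := hkey
        _ ≤ C' * (K ^ 2 * δ ^ 2) + (C' - 1) * ((A + 1) * δ) ^ 2 + ((A - L * B + 1) * δ) ^ 2 := by gcongr
        _ = (C' * K ^ 2 + (C' - 1) * (A + 1) ^ 2 + (A - L * B + 1) ^ 2) * δ ^ 2 := by ring
    have h2 : C' * e' ^ 2 ≤ C' * ((A - B - 1) * δ) ^ 2 := by
      calc C' * e' ^ 2 ≤ (C' * K ^ 2 + (C' - 1) * (A + 1) ^ 2 + (A - L * B + 1) ^ 2) * δ ^ 2 := h1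
        _ ≤ (C' * (A - B - 1) ^ 2) * δ ^ 2 := mul_le_mul_of_nonneg_right htarget (sq_nonneg δ)
        _ = C' * ((A - B - 1) * δ) ^ 2 := by ring
    exact le_of_mul_le_mul_left h2 hC'0
  have h2B : 2 * B ≤ L * B := mul_le_mul_of_nonneg_right (by linarith) (by linarith)
  have hpos : 0 ≤ (A - B - 1) * δ := mul_nonneg (by linarith) hδ.le
  exact le_of_sq_le_sq he'sq hpos

/-- Vectors of `ℝk` lie in `span Q` when `k` does. [folklore] -/
theorem mem_modeSpan_of_mem_span_kvec (hkV : kvec k ∈ modeSpan Q) (hv : v ∈ ℝ ∙ kvec k) : v ∈ modeSpan Q :=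
  (Submodule.span_singleton_le_iff_mem _ _).2 hkV hv

/-- **Lemma 2, main condition**: translates `ω + v`, `v ∈ ℝk`, `‖v‖ ≤ δ`, satisfy `d_Q(ω + v) ≤ L^p δ`.
[cite: DeRoeckHuveneers2015, §4.3 proof of Lemma 2 (first point: "`|ω' + tk|₂ ≤ … ≤ Kδ + (L^p - L)δ + r²δ ≤ L^p δ`")] -/
theorem lemma2_main (hC : IsLemma1Const m r C) (hK : 0 ≤ K) (hL : lemmaL C K ≤ L) (hδ : 0 < δ)
    (hk : k ∈ BModes m r) (hkV : kvec k ∈ modeSpan Q)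
    (hω : InEnlarged r L δ Q ω) (hres : |⟪kvec k, ω⟫_ℝ| ≤ K * δ) (hv : v ∈ ℝ ∙ kvec k) (hvn : ‖v‖ ≤ δ) :
    dQ Q (ω + v) ≤ L ^ Q.card * δ := by
  have hk0 : k ≠ 0 := (mem_BModes.1 hk).1
  have hsing : ({k} : Finset (Fin m → ℤ)) ∈ subFamilies r Q := singleton_mem_subFamilies hk hkV
  have h1 : eQ Q {k} ω < (L ^ Q.card - L ^ 1 + 1) * δ := by simpa using hω.2 _ hsing
  have h2 : dQ {k} ω ≤ K * δ := (dQ_singleton_le hk0 ω).trans hres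
  have hL2 : K + 2 ≤ L := by
    have : 0 ≤ 2 * C ^ 2 * (6 + K ^ 2) := by positivity
    have hC1 := hC.1
    have : K + 2 ≤ C * (K + 2) := le_mul_of_one_le_left (by linarith) hC1
    rw [lemmaL] at hL; linarith
  rw [dQ_translate (mem_modeSpan_of_mem_span_kvec hkV hv)]
  have h3 : (K + 2 - L) * δ ≤ 0 := mul_nonpos_of_nonpos_of_nonneg (by linarith) hδ.le
  calc ‖proj Q ω + v‖ ≤ ‖proj Q ω‖ + ‖v‖ := norm_add_le _ _
    _ ≤ (‖proj {k} ω‖ + ‖proj Q ω - proj {k} ω‖) + ‖v‖ := by gcongr; exact norm_le_norm_add_norm_sub' _ _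
    _ = dQ {k} ω + eQ Q {k} ω + ‖v‖ := rfl
    _ ≤ K * δ + (L ^ Q.card - L + 1) * δ + δ := by linarith
    _ ≤ L ^ Q.card * δ := by linarith

/-- **Lemma 2, sub-families not containing `k`**: `e_{Q,Q'}(ω + v) ≤ (L^p - L^{p'})δ`.
[cite: DeRoeckHuveneers2015, §4.3 proof of Lemma 2 (second point)] -/
theorem lemma2_sub (hC : IsLemma1Const m r C) (hK : 0 ≤ K) (hL : lemmaL C K ≤ L) (hδ : 0 < δ)
    (hQli : IsLI Q) (hk : k ∈ BModes m r) (hkV : kvec k ∈ modeSpan Q)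
    (hω : InEnlarged r L δ Q ω) (hres : |⟪kvec k, ω⟫_ℝ| ≤ K * δ) (hv : v ∈ ℝ ∙ kvec k) (hvn : ‖v‖ ≤ δ)
    {Q' : Finset (Fin m → ℤ)} (hQ' : Q' ∈ subFamilies r Q) (hkQ' : kvec k ∉ modeSpan Q') :
    eQ Q Q' (ω + v) ≤ (L ^ Q.card - L ^ Q'.card) * δ := by
  have h1 := lemma2_slack hC hK hL hδ hQli hk hkV hω hres hQ' hkQ'
  have h2 := eQ_translate_le (Q := Q) (Q' := Q') (mem_modeSpan_of_mem_span_kvec hkV hv) ω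
  linarith

/-- **Lemma 2, sub-families containing `k`**: `e_{Q,Q'}(ω + v) = e_{Q,Q'}(ω)`. [cite: DeRoeckHuveneers2015, §4.3 proof of Lemma 2 ("if `k ∈ span{k'_1, …, k'_{p'}}`, then … actually satisfied for all `t ∈ ℝ`")] -/
theorem lemma2_fixed {Q' : Finset (Fin m → ℤ)} (hQ' : Q' ∈ subFamilies r Q) (hkQ' : kvec k ∈ modeSpan Q') (hv : v ∈ ℝ ∙ kvec k)
    (ω : Euc m) : eQ Q Q' (ω + v) = eQ Q Q' ω :=
  eQ_translate_of_mem (mem_subFamilies.1 hQ').2.2.2 (mem_modeSpan_of_mem_span_kvec hkQ' hv) ω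

end Lemma2

/-! ### Lemma 3 -/

section Lemma3

variable {C K L δ : ℝ} {Q : Finset (Fin m → ℤ)} {k : Fin m → ℤ} {ω : Euc m}

/-- **Lemma 3**: for a bounded `k ∉ span Q` with `|⟪k,ω⟫| ≤ Kδ` and `ω` in the enlarged block of `Q`,
`ω` lies in the CORE block of `Q ∪ {k}`: `d ≤ L^{p+1}δ` and `e ≤ (L^{p+1} - L^{p'})δ` for all
sub-families — in fact with the slack `d ≤ (L-1)L^p δ`. [cite: DeRoeckHuveneers2015, §4.3 Lemma 3] -/
theorem lemma3 (hC : IsLemma1Const m r C) (hK : 0 ≤ K) (hL : lemmaL C K ≤ L) (hδ : 0 < δ)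
    (hQ : Q ⊆ BModes m r) (hQli : IsLI Q) (hk : k ∈ BModes m r) (hkV : kvec k ∉ modeSpan Q)
    (hω : InEnlarged r L δ Q ω) (hres : |⟪kvec k, ω⟫_ℝ| ≤ K * δ) :
    dQ (insert k Q) ω ≤ (L - 1) * L ^ Q.card * δ ∧ InCore r L δ (insert k Q) ω := by
  have hC1 := hC.1
  have hkQ : k ∉ Q := fun h => hkV (kvec_mem_modeSpan h)
  have hcard : (insert k Q).card = Q.card + 1 := Finset.card_insert_of_notMem hkQ
  have hL1 : 1 ≤ L := by
    have : 0 ≤ 2 * C ^ 2 * (6 + K ^ 2) + C * (K + 2) := by positivity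
    rw [lemmaL] at hL; linarith
  set A : ℝ := L ^ Q.card with hA
  have hA1 : 1 ≤ A := one_le_pow₀ hL1
  -- `d⁺ ≤ C(Kδ + dQ) ≤ C(K + A + 1)δ ≤ C(K+2)A δ ≤ (L-1)Aδ`
  have hLem1 := hC.2 Q k (fun k' hk' => (mem_BModes.1 (hQ hk')).2) (mem_BModes.1 hk).2 hkV ω
  have hd : dQ (insert k Q) ω ≤ (L - 1) * A * δ := by
    have h1 : dQ (insert k Q) ω ≤ C * (K * δ + (A + 1) * δ) :=
      hLem1.trans (mul_le_mul_of_nonneg_left (add_le_add hres hω.1.le) (by linarith))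
    have h2 : K * δ + (A + 1) * δ ≤ (K + 2) * A * δ := by
      have : (K + A + 1) ≤ (K + 2) * A := by nlinarith
      nlinarith [hδ.le]
    have h3 : C * (K + 2) ≤ L - 1 := by
      have : 0 ≤ 2 * C ^ 2 * (6 + K ^ 2) := by positivity
      rw [lemmaL] at hL; linarith
    calc dQ (insert k Q) ω ≤ C * (K * δ + (A + 1) * δ) := h1
      _ ≤ C * ((K + 2) * A * δ) := mul_le_mul_of_nonneg_left h2 (by linarith)
      _ = (C * (K + 2)) * (A * δ) := by ring
      _ ≤ (L - 1) * (A * δ) := mul_le_mul_of_nonneg_right h3 (by positivity)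
      _ = (L - 1) * A * δ := by ring
  refine ⟨hd, ?_, fun Q' hQ' => ?_⟩
  · rw [hcard, pow_succ]
    calc dQ (insert k Q) ω ≤ (L - 1) * A * δ := hd
      _ ≤ A * L * δ := by nlinarith [hδ.le]
  · obtain ⟨hQ'sub, hQ'ne, hQ'li, hQ'le⟩ := mem_subFamilies.1 hQ'
    have hli : IsLI (insert k Q) := hQli.insert hkV
    have hcard' : Q'.card ≤ Q.card + 1 := by rw [← hcard]; exact card_le_of_isLI_of_le hli hQ'li hQ'le
    rw [hcard]
    rcases Nat.lt_or_ge Q'.card (Q.card + 1) with hlt | hge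
    · -- `p' ≤ p`: `e ≤ d⁺ ≤ (L-1)Aδ = (L^{p+1} - L^p)δ ≤ (L^{p+1} - L^{p'})δ`
      have hp' : Q'.card ≤ Q.card := Nat.lt_succ_iff.1 hlt
      have hpow : L ^ Q'.card ≤ A := pow_le_pow_right₀ hL1 hp'
      calc eQ (insert k Q) Q' ω ≤ dQ (insert k Q) ω := eQ_le_dQ hQ'le ω
        _ ≤ (L - 1) * A * δ := hd
        _ = (L ^ (Q.card + 1) - A) * δ := by rw [pow_succ]; ring
        _ ≤ (L ^ (Q.card + 1) - L ^ Q'.card) * δ := by nlinarith [hδ.le]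
    · -- `p' = p + 1`: the spans agree, `e = 0`
      have heq : Q'.card = Q.card + 1 := le_antisymm hcard' hge
      have hspan : modeSpan Q' = modeSpan (insert k Q) := modeSpan_eq_of_card_eq hli hQ'li hQ'le (by rw [heq, hcard])
      rw [eQ_eq_zero_of_eq hspan, heq, sub_self, zero_mul]

end Lemma3

end Literature.Barriers.AtomisticToContinuum.HeatConduction.RotorChain

end
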